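import Summits.Ventures.YMGap.RobustBall.FourPointToolsS
import Summits.Ventures.YMGap.Thresholds.ConnectedFourPointCrude
import HarnessLib

/-!
# Venture YMGap, track ROBUST-BALL (Y2) — TIER 2: THE TWO SPLIT BOUNDS OF THE FOURTH CUMULANT OF ARBITRARY LOCAL OBSERVABLES, UNIFORMLY ON THE
# WEIGHTED BALL (one slot isolated; pair against pair) — groundwork for the tree decay of `u₄` and `C³` along the lines of the ball

HONEST FRAMING. WHAT THIS IS: a venture file (cell `pub-ymgap`, track Y2 ROBUST-BALL, seat rb-p1, theorems only): the BALL twin, for four ARBITRARY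
bounded local Frobenius-Lipschitz observables `f, g, h, k` (supports `Δ_•`, vectors `δ_•` with sums `S_•`, bounds `M_•`), of ds-1's split bounds of the
connected four-point function of the Wilson state (`Thresholds/ConnectedFourPointBounds.lean`).  Member `W ∈ MemBallZdS a Λ_t t` inside the one-link
pair door `ρ := 6(d−1)|β| e^{a} e^{t} √(cv) + e^{a/2} √c Λ_t < 1` (`t ≥ 0`), ANY DLR state `μ`; `u₄` in ds-1's DERIVATIVE FORM
`u₄(f;g;h;k) = u₃(fg; h; k) − cov(f,k)cov(g,h) − ⟨f⟩u₃(g;h;k) − cov(g,k)cov(f,h) − ⟨g⟩u₃(f;h;k)` (`ConnectedFourPointAlgebra`):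
(tools: `FourPointToolsS` — set-distance monotonicity, `abs_cov_le_S'`, `abs_cov_prod_prod_le_S`):
* ★ `abs_fourPoint_le_isolated_S` — `k` ISOLATED: `|u₄(f;g;h;k)| ≤ 48N (M_fM_gS_h + M_fM_hS_g + M_gM_hS_f) S_k e^{−t d(Δ_f∪Δ_g∪Δ_h, Δ_k)}`;
* ★ `abs_fourPoint_le_pair_S` — PAIR AGAINST PAIR: `|u₄(f;g;h;k)| ≤ 48N (M_fS_g + M_gS_f)(M_hS_k + M_kS_h) e^{−t d(Δ_f∪Δ_g, Δ_h∪Δ_k)}` (ds-1's cross form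
  `fourPoint_pair_form`).
With the transpositions of `ConnectedFourPointAlgebra` these give all seven bipartitions (successor file `FourPointDecayS`: tree decay).
WHAT THIS IS NOT: a tree bound yet; one-sided Dobrushin-comparison constants at lattice strong coupling; nothing about the continuum limit or a Clay-sense
mass gap.
-/

noncomputable section

open MeasureTheory Function Finset ProbabilityTheory Real
open scoped NNReal
open Literature.Probability.LatticeModels
open Literature.Probability.LatticeModels.DobrushinMetric
open Literature.MathematicalPhysics.QuantumLattice
open Literature.MathematicalPhysics.QuantumFieldTheory hiding ZdEdge
open Summit.Ventures.YMGap.CouplingResponse (abs_threePoint_le abs_sub4_le abs_cov_le_two_mul abs_mul_le_mul_of_abs_le fourPoint_pair_form)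

namespace Summit.Ventures.YMGap.RobustBall

variable {d N : ℕ}

section SUN

variable {W : Potential (ZdEdge d) (Matrix.specialUnitaryGroup (Fin N) ℂ)}

/-- Local shorthand: the connected three-point function `u₃(X; Y; Z)` under `μ`. -/
local notation3 (prettyPrint := false) "U₃[" X ";" Y ";" Z ";" μ "]" =>
  cov[fun ω => X ω * Y ω, Z; μ] - (∫ ω, X ω ∂μ) * cov[Y, Z; μ] - (∫ ω, Y ω ∂μ) * cov[X, Z; μ]

/-- Local shorthand: the connected four-point function in derivative form `u₄(X; Y; Z; W)` under `μ`. -/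
local notation3 (prettyPrint := false) "U₄[" X ";" Y ";" Z ";" W' ";" μ "]" =>
  (cov[fun ω => (X ω * Y ω) * Z ω, W'; μ] - (∫ ω, X ω * Y ω ∂μ) * cov[Z, W'; μ] - (∫ ω, Z ω ∂μ) * cov[fun ω => X ω * Y ω, W'; μ])
  - cov[X, W'; μ] * cov[Y, Z; μ] - (∫ ω, X ω ∂μ) * U₃[Y ; Z ; W' ; μ]
  - cov[Y, W'; μ] * cov[X, Z; μ] - (∫ ω, Y ω ∂μ) * U₃[X ; Z ; W' ; μ]

/-! ### The split with `k` isolated -/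

/-- ★ **THE SPLIT OF THE FOURTH CUMULANT WITH `k` ISOLATED, uniformly on the weighted ball.**  Member `W ∈ MemBallZdS a Λ_t t` in the pair door
(`t ≥ 0`), ANY DLR `μ`, `f, g, h, k` bounded measurable local Frobenius-Lipschitz:
`|u₄(f;g;h;k)| ≤ 48N (M_fM_g S_h + M_fM_h S_g + M_gM_h S_f) S_k e^{−t d(Δ_f∪Δ_g∪Δ_h, Δ_k)}`. -/
theorem abs_fourPoint_le_isolated_S (hd : 1 ≤ d) (hN : 1 ≤ N) {β b c v a Λt t : ℝ}
    (hc : 0 ≤ c) (hv : 0 ≤ v) (hb : |β| * (2 * ((d : ℝ) - 1)) ≤ b)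
    (hP : ∀ B : Matrix (Fin N) (Fin N) ℂ, matrixOpNorm B ≤ b →
      ∀ (ψ : Matrix.specialUnitaryGroup (Fin N) ℂ → ℝ) (M : ℝ), 0 ≤ M →
        (∀ x y, |ψ x - ψ y| ≤ M * suFrobDist x y) →
        Var[ψ; (haarProbability (Matrix.specialUnitaryGroup (Fin N) ℂ)).tilted
          fun g => (N : ℝ) * ((g : Matrix (Fin N) (Fin N) ℂ) * B).trace.re] ≤ c * M ^ 2)
    (hVB : ∀ B : Matrix (Fin N) (Fin N) ℂ, matrixOpNorm B ≤ b → ∀ Δ : Matrix (Fin N) (Fin N) ℂ,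
      Var[fun g : Matrix.specialUnitaryGroup (Fin N) ℂ =>
          (N : ℝ) * ((g : Matrix (Fin N) (Fin N) ℂ) * Δ).trace.re;
        (haarProbability (Matrix.specialUnitaryGroup (Fin N) ℂ)).tilted
          fun g => (N : ℝ) * ((g : Matrix (Fin N) (Fin N) ℂ) * B).trace.re] ≤ v * frobNorm Δ ^ 2)
    (ht : 0 ≤ t) (hρ : 6 * ((d : ℝ) - 1) * |β| * (exp a * exp t * Real.sqrt (c * v)) + exp (a / 2) * Real.sqrt c * Λt < 1)
    (hW : MemBallZdS a Λt t W) {μ : Measure (LGConfig d (Matrix.specialUnitaryGroup (Fin N) ℂ))}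
    (hμ : μ ∈ perturbedGibbsMeasuresS (d := d) (fundamentalRep (Fin N)) (N * β) W)
    {f : LGConfig d (Matrix.specialUnitaryGroup (Fin N) ℂ) → ℝ} (hfm : Measurable f) {Δf : Finset (ZdEdge d)}
    (hfdep : DependsOn f (↑Δf : Set (ZdEdge d))) {Mf : ℝ} (hMf : ∀ σ, |f σ| ≤ Mf) {δf : ZdEdge d → ℝ} (hδf : IsLipBound suFrobDist f δf)
    {g : LGConfig d (Matrix.specialUnitaryGroup (Fin N) ℂ) → ℝ} (hgm : Measurable g) {Δg : Finset (ZdEdge d)}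
    (hgdep : DependsOn g (↑Δg : Set (ZdEdge d))) {Mg : ℝ} (hMg : ∀ σ, |g σ| ≤ Mg) {δg : ZdEdge d → ℝ} (hδg : IsLipBound suFrobDist g δg)
    {h : LGConfig d (Matrix.specialUnitaryGroup (Fin N) ℂ) → ℝ} (hhm : Measurable h) {Δh : Finset (ZdEdge d)}
    (hhdep : DependsOn h (↑Δh : Set (ZdEdge d))) {Mh : ℝ} (hMh : ∀ σ, |h σ| ≤ Mh) {δh : ZdEdge d → ℝ} (hδh : IsLipBound suFrobDist h δh)
    {k : LGConfig d (Matrix.specialUnitaryGroup (Fin N) ℂ) → ℝ} (hkm : Measurable k) {Δk : Finset (ZdEdge d)}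
    (hkdep : DependsOn k (↑Δk : Set (ZdEdge d))) {Mk : ℝ} (hMk : ∀ σ, |k σ| ≤ Mk) {δk : ZdEdge d → ℝ} (hδk : IsLipBound suFrobDist k δk) :
    |U₄[f ; g ; h ; k ; μ]| ≤
      48 * N * (Mf * Mg * ∑ y ∈ Δh, δh y + Mf * Mh * ∑ y ∈ Δg, δg y + Mg * Mh * ∑ y ∈ Δf, δf y) * (∑ y ∈ Δk, δk y) *
        exp (-(t * setDistEdges (Δf ∪ Δg ∪ Δh) Δk)) := by
  classical
  have hμP : IsGibbsMeasure (perturbedYMS (d := d) (fundamentalRep (Fin N)) (N * β) W) μ := hμ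
  haveI := hμP.isProbabilityMeasure
  have hMf0 : 0 ≤ Mf := (abs_nonneg _).trans (hMf 1); have hMg0 : 0 ≤ Mg := (abs_nonneg _).trans (hMg 1)
  have hMh0 : 0 ≤ Mh := (abs_nonneg _).trans (hMh 1)
  obtain ⟨Sf, hSf⟩ : ∃ S : ℝ, S = ∑ y ∈ Δf, δf y := ⟨_, rfl⟩
  obtain ⟨Sg, hSg⟩ : ∃ S : ℝ, S = ∑ y ∈ Δg, δg y := ⟨_, rfl⟩
  obtain ⟨Sh, hSh⟩ : ∃ S : ℝ, S = ∑ y ∈ Δh, δh y := ⟨_, rfl⟩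
  obtain ⟨Sk, hSk⟩ : ∃ S : ℝ, S = ∑ y ∈ Δk, δk y := ⟨_, rfl⟩
  have hSf0 : 0 ≤ Sf := hSf ▸ sum_nonneg fun y _ => hδf.nonneg y; have hSg0 : 0 ≤ Sg := hSg ▸ sum_nonneg fun y _ => hδg.nonneg y
  have hSh0 : 0 ≤ Sh := hSh ▸ sum_nonneg fun y _ => hδh.nonneg y; have hSk0 : 0 ≤ Sk := hSk ▸ sum_nonneg fun y _ => hδk.nonneg y
  have hSf_e : ¬Δf.Nonempty → Sf = 0 := fun hn => by rw [hSf, Finset.not_nonempty_iff_eq_empty.1 hn, sum_empty]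
  have hSg_e : ¬Δg.Nonempty → Sg = 0 := fun hn => by rw [hSg, Finset.not_nonempty_iff_eq_empty.1 hn, sum_empty]
  have hSh_e : ¬Δh.Nonempty → Sh = 0 := fun hn => by rw [hSh, Finset.not_nonempty_iff_eq_empty.1 hn, sum_empty]
  have hSk_e : ¬Δk.Nonempty → Sk = 0 := fun hn => by rw [hSk, Finset.not_nonempty_iff_eq_empty.1 hn, sum_empty]
  rw [← hSf, ← hSg, ← hSh, ← hSk]
  obtain ⟨E, hE⟩ : ∃ x : ℝ, x = exp (-(t * setDistEdges (Δf ∪ Δg ∪ Δh) Δk)) := ⟨_, rfl⟩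
  rw [← hE]
  have hNN : (0 : ℝ) ≤ N := Nat.cast_nonneg N
  -- the product observable `fg`
  have hpm : Measurable fun σ => f σ * g σ := hfm.mul hgm
  have hpdep := dependsOn_mul_union' hfdep hgdep
  have hMp : ∀ σ, |f σ * g σ| ≤ Mf * Mg := fun σ => by rw [abs_mul]; exact mul_le_mul (hMf σ) (hMg σ) (abs_nonneg _) hMf0
  have hplip := isLipBound_mul_restrict (fun _ _ => suFrobDist_nonneg _ _) hfdep hgdep hMf hMg hMf0 hMg0 hδf hδg
  -- term 1: `u₃(fg; h; k)`, distance exactly `d(Δ_f ∪ Δ_g ∪ Δ_h, Δ_k)`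
  have T1 : |cov[fun σ => (f σ * g σ) * h σ, k; μ] - (∫ σ, f σ * g σ ∂μ) * cov[h, k; μ] - (∫ σ, h σ ∂μ) * cov[fun σ => f σ * g σ, k; μ]| ≤
      16 * N * (Mf * Mg * Sh + Mh * (Mf * Sg + Mg * Sf)) * Sk * E := by
    have h1 := abs_threePoint_le_split_S hd hN hc hv hb hP hVB ht hρ hW hμ hpm hpdep hMp hplip hhm hhdep hMh hδh hkm hkdep hMk hδk
    rw [sum_union_mul_restrict, ← hSf, ← hSg, ← hSh, ← hSk, ← hE] at h1
    exact h1
  -- terms 2 and 4: `cov(f,k) cov(g,h)` and `cov(g,k) cov(f,h)`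
  have T2 : |cov[f, k; μ]| * |cov[g, h; μ]| ≤ 8 * N * Sf * Sk * E * (2 * Mg * Mh) := by
    have h1 := abs_cov_le_S' hd hN hc hv hb hP hVB ht hρ hW hμ hfm hfdep hMf hδf hkm hkdep hMk hδk
    rw [← hSf, ← hSk] at h1
    have h2 : 8 * N * Sf * Sk * exp (-(t * setDistEdges Δf Δk)) ≤ 8 * N * Sf * Sk * E := by
      rw [hE]; exact mul_exp_neg_setDistEdges_mono ht (by positivity) (Finset.subset_union_left.trans Finset.subset_union_left) subset_rfl
        (fun hn => by rw [hSf_e hn]; ring) (fun hn => by rw [hSk_e hn]; ring)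
    exact mul_le_mul (h1.trans h2) (abs_cov_le_two_mul hgm hhm hMg hMh) (abs_nonneg _) (by rw [hE]; positivity)
  have T4 : |cov[g, k; μ]| * |cov[f, h; μ]| ≤ 8 * N * Sg * Sk * E * (2 * Mf * Mh) := by
    have h1 := abs_cov_le_S' hd hN hc hv hb hP hVB ht hρ hW hμ hgm hgdep hMg hδg hkm hkdep hMk hδk
    rw [← hSg, ← hSk] at h1
    have h2 : 8 * N * Sg * Sk * exp (-(t * setDistEdges Δg Δk)) ≤ 8 * N * Sg * Sk * E := by
      rw [hE]; exact mul_exp_neg_setDistEdges_mono ht (by positivity) (Finset.subset_union_right.trans Finset.subset_union_left) subset_rfl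
        (fun hn => by rw [hSg_e hn]; ring) (fun hn => by rw [hSk_e hn]; ring)
    exact mul_le_mul (h1.trans h2) (abs_cov_le_two_mul hfm hhm hMf hMh) (abs_nonneg _) (by rw [hE]; positivity)
  -- terms 3 and 5: `⟨f⟩ u₃(g;h;k)` and `⟨g⟩ u₃(f;h;k)`
  have T3 : |∫ σ, f σ ∂μ| * |U₃[g ; h ; k ; μ]| ≤ Mf * (16 * N * (Mg * Sh + Mh * Sg) * Sk * E) := by
    have h1 := abs_threePoint_le_split_S hd hN hc hv hb hP hVB ht hρ hW hμ hgm hgdep hMg hδg hhm hhdep hMh hδh hkm hkdep hMk hδk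
    rw [← hSg, ← hSh, ← hSk] at h1
    have h2 : 16 * N * (Mg * Sh + Mh * Sg) * Sk * exp (-(t * setDistEdges (Δg ∪ Δh) Δk)) ≤ 16 * N * (Mg * Sh + Mh * Sg) * Sk * E := by
      rw [hE]
      refine mul_exp_neg_setDistEdges_mono ht (by positivity) ?_ subset_rfl (fun hn => ?_) (fun hn => by rw [hSk_e hn]; ring)
      · intro x hx; rcases Finset.mem_union.1 hx with hx | hx
        · exact Finset.mem_union_left _ (Finset.mem_union_right _ hx)
        · exact Finset.mem_union_right _ hx
      · have hg' : ¬Δg.Nonempty := fun h' => hn (h'.mono Finset.subset_union_left)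
        have hh' : ¬Δh.Nonempty := fun h' => hn (h'.mono Finset.subset_union_right)
        rw [hSg_e hg', hSh_e hh']; ring
    exact mul_le_mul (Summit.Ventures.YMGap.CouplingResponse.abs_integral_le_of_abs_le hMf) (h1.trans h2) (abs_nonneg _) hMf0
  have T5 : |∫ σ, g σ ∂μ| * |U₃[f ; h ; k ; μ]| ≤ Mg * (16 * N * (Mf * Sh + Mh * Sf) * Sk * E) := by
    have h1 := abs_threePoint_le_split_S hd hN hc hv hb hP hVB ht hρ hW hμ hfm hfdep hMf hδf hhm hhdep hMh hδh hkm hkdep hMk hδk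
    rw [← hSf, ← hSh, ← hSk] at h1
    have h2 : 16 * N * (Mf * Sh + Mh * Sf) * Sk * exp (-(t * setDistEdges (Δf ∪ Δh) Δk)) ≤ 16 * N * (Mf * Sh + Mh * Sf) * Sk * E := by
      rw [hE]
      refine mul_exp_neg_setDistEdges_mono ht (by positivity) ?_ subset_rfl (fun hn => ?_) (fun hn => by rw [hSk_e hn]; ring)
      · intro x hx; rcases Finset.mem_union.1 hx with hx | hx
        · exact Finset.mem_union_left _ (Finset.mem_union_left _ hx)
        · exact Finset.mem_union_right _ hx
      · have hf' : ¬Δf.Nonempty := fun h' => hn (h'.mono Finset.subset_union_left)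
        have hh' : ¬Δh.Nonempty := fun h' => hn (h'.mono Finset.subset_union_right)
        rw [hSf_e hf', hSh_e hh']; ring
    exact mul_le_mul (Summit.Ventures.YMGap.CouplingResponse.abs_integral_le_of_abs_le hMg) (h1.trans h2) (abs_nonneg _) hMg0
  refine (abs_sub4_le _ _ _ _ _).trans ?_
  rw [abs_mul, abs_mul, abs_mul, abs_mul]
  calc _ ≤ 16 * N * (Mf * Mg * Sh + Mh * (Mf * Sg + Mg * Sf)) * Sk * E + 8 * N * Sf * Sk * E * (2 * Mg * Mh) +
        Mf * (16 * N * (Mg * Sh + Mh * Sg) * Sk * E) + 8 * N * Sg * Sk * E * (2 * Mf * Mh) + Mg * (16 * N * (Mf * Sh + Mh * Sf) * Sk * E) :=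
        add_le_add (add_le_add (add_le_add (add_le_add T1 T2) T3) T4) T5
    _ = 48 * N * (Mf * Mg * Sh + Mf * Mh * Sg + Mg * Mh * Sf) * Sk * E := by ring

/-! ### The pair split `{f, g} | {h, k}` -/

/-- ★ **THE PAIR SPLIT OF THE FOURTH CUMULANT, uniformly on the weighted ball.**  Under the hypotheses of `abs_fourPoint_le_isolated_S`:
`|u₄(f;g;h;k)| ≤ 48N (M_fS_g + M_gS_f)(M_hS_k + M_kS_h) e^{−t d(Δ_f∪Δ_g, Δ_h∪Δ_k)}`. -/
theorem abs_fourPoint_le_pair_S (hd : 1 ≤ d) (hN : 1 ≤ N) {β b c v a Λt t : ℝ}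
    (hc : 0 ≤ c) (hv : 0 ≤ v) (hb : |β| * (2 * ((d : ℝ) - 1)) ≤ b)
    (hP : ∀ B : Matrix (Fin N) (Fin N) ℂ, matrixOpNorm B ≤ b →
      ∀ (ψ : Matrix.specialUnitaryGroup (Fin N) ℂ → ℝ) (M : ℝ), 0 ≤ M →
        (∀ x y, |ψ x - ψ y| ≤ M * suFrobDist x y) →
        Var[ψ; (haarProbability (Matrix.specialUnitaryGroup (Fin N) ℂ)).tilted
          fun g => (N : ℝ) * ((g : Matrix (Fin N) (Fin N) ℂ) * B).trace.re] ≤ c * M ^ 2)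
    (hVB : ∀ B : Matrix (Fin N) (Fin N) ℂ, matrixOpNorm B ≤ b → ∀ Δ : Matrix (Fin N) (Fin N) ℂ,
      Var[fun g : Matrix.specialUnitaryGroup (Fin N) ℂ =>
          (N : ℝ) * ((g : Matrix (Fin N) (Fin N) ℂ) * Δ).trace.re;
        (haarProbability (Matrix.specialUnitaryGroup (Fin N) ℂ)).tilted
          fun g => (N : ℝ) * ((g : Matrix (Fin N) (Fin N) ℂ) * B).trace.re] ≤ v * frobNorm Δ ^ 2)
    (ht : 0 ≤ t) (hρ : 6 * ((d : ℝ) - 1) * |β| * (exp a * exp t * Real.sqrt (c * v)) + exp (a / 2) * Real.sqrt c * Λt < 1)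
    (hW : MemBallZdS a Λt t W) {μ : Measure (LGConfig d (Matrix.specialUnitaryGroup (Fin N) ℂ))}
    (hμ : μ ∈ perturbedGibbsMeasuresS (d := d) (fundamentalRep (Fin N)) (N * β) W)
    {f : LGConfig d (Matrix.specialUnitaryGroup (Fin N) ℂ) → ℝ} (hfm : Measurable f) {Δf : Finset (ZdEdge d)}
    (hfdep : DependsOn f (↑Δf : Set (ZdEdge d))) {Mf : ℝ} (hMf : ∀ σ, |f σ| ≤ Mf) {δf : ZdEdge d → ℝ} (hδf : IsLipBound suFrobDist f δf)
    {g : LGConfig d (Matrix.specialUnitaryGroup (Fin N) ℂ) → ℝ} (hgm : Measurable g) {Δg : Finset (ZdEdge d)}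
    (hgdep : DependsOn g (↑Δg : Set (ZdEdge d))) {Mg : ℝ} (hMg : ∀ σ, |g σ| ≤ Mg) {δg : ZdEdge d → ℝ} (hδg : IsLipBound suFrobDist g δg)
    {h : LGConfig d (Matrix.specialUnitaryGroup (Fin N) ℂ) → ℝ} (hhm : Measurable h) {Δh : Finset (ZdEdge d)}
    (hhdep : DependsOn h (↑Δh : Set (ZdEdge d))) {Mh : ℝ} (hMh : ∀ σ, |h σ| ≤ Mh) {δh : ZdEdge d → ℝ} (hδh : IsLipBound suFrobDist h δh)
    {k : LGConfig d (Matrix.specialUnitaryGroup (Fin N) ℂ) → ℝ} (hkm : Measurable k) {Δk : Finset (ZdEdge d)}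
    (hkdep : DependsOn k (↑Δk : Set (ZdEdge d))) {Mk : ℝ} (hMk : ∀ σ, |k σ| ≤ Mk) {δk : ZdEdge d → ℝ} (hδk : IsLipBound suFrobDist k δk) :
    |U₄[f ; g ; h ; k ; μ]| ≤
      48 * N * (Mf * ∑ y ∈ Δg, δg y + Mg * ∑ y ∈ Δf, δf y) * (Mh * ∑ y ∈ Δk, δk y + Mk * ∑ y ∈ Δh, δh y) *
        exp (-(t * setDistEdges (Δf ∪ Δg) (Δh ∪ Δk))) := by
  classical
  have hμP : IsGibbsMeasure (perturbedYMS (d := d) (fundamentalRep (Fin N)) (N * β) W) μ := hμ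
  haveI := hμP.isProbabilityMeasure
  have hMf0 : 0 ≤ Mf := (abs_nonneg _).trans (hMf 1); have hMg0 : 0 ≤ Mg := (abs_nonneg _).trans (hMg 1)
  have hMh0 : 0 ≤ Mh := (abs_nonneg _).trans (hMh 1); have hMk0 : 0 ≤ Mk := (abs_nonneg _).trans (hMk 1)
  obtain ⟨Sf, hSf⟩ : ∃ S : ℝ, S = ∑ y ∈ Δf, δf y := ⟨_, rfl⟩
  obtain ⟨Sg, hSg⟩ : ∃ S : ℝ, S = ∑ y ∈ Δg, δg y := ⟨_, rfl⟩
  obtain ⟨Sh, hSh⟩ : ∃ S : ℝ, S = ∑ y ∈ Δh, δh y := ⟨_, rfl⟩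
  obtain ⟨Sk, hSk⟩ : ∃ S : ℝ, S = ∑ y ∈ Δk, δk y := ⟨_, rfl⟩
  have hSf0 : 0 ≤ Sf := hSf ▸ sum_nonneg fun y _ => hδf.nonneg y; have hSg0 : 0 ≤ Sg := hSg ▸ sum_nonneg fun y _ => hδg.nonneg y
  have hSh0 : 0 ≤ Sh := hSh ▸ sum_nonneg fun y _ => hδh.nonneg y; have hSk0 : 0 ≤ Sk := hSk ▸ sum_nonneg fun y _ => hδk.nonneg y
  have hSf_e : ¬Δf.Nonempty → Sf = 0 := fun hn => by rw [hSf, Finset.not_nonempty_iff_eq_empty.1 hn, sum_empty]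
  have hSg_e : ¬Δg.Nonempty → Sg = 0 := fun hn => by rw [hSg, Finset.not_nonempty_iff_eq_empty.1 hn, sum_empty]
  have hSh_e : ¬Δh.Nonempty → Sh = 0 := fun hn => by rw [hSh, Finset.not_nonempty_iff_eq_empty.1 hn, sum_empty]
  have hSk_e : ¬Δk.Nonempty → Sk = 0 := fun hn => by rw [hSk, Finset.not_nonempty_iff_eq_empty.1 hn, sum_empty]
  rw [fourPoint_pair_form hfm hgm hhm hkm hMf hMg hMh hMk, ← hSf, ← hSg, ← hSh, ← hSk]
  obtain ⟨E, hE⟩ : ∃ x : ℝ, x = exp (-(t * setDistEdges (Δf ∪ Δg) (Δh ∪ Δk))) := ⟨_, rfl⟩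
  rw [← hE]
  have hE0 : 0 ≤ E := by rw [hE]; exact (exp_pos _).le
  have hNN : (0 : ℝ) ≤ N := Nat.cast_nonneg N
  have hunion_e : ∀ {A B : Finset (ZdEdge d)} {SA SB : ℝ}, (¬A.Nonempty → SA = 0) → (¬B.Nonempty → SB = 0) → ¬(A ∪ B).Nonempty →
      SA = 0 ∧ SB = 0 := fun hA hB hn =>
    ⟨hA fun h' => hn (h'.mono Finset.subset_union_left), hB fun h' => hn (h'.mono Finset.subset_union_right)⟩
  -- cross covariances, all transported to the distance `d(Δ_f ∪ Δ_g, Δ_h ∪ Δ_k)` (written from the `{h,k}` side and flipped by symmetry)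
  have hEsym : exp (-(t * setDistEdges (Δh ∪ Δk) (Δf ∪ Δg))) = E := by rw [hE, setDistEdges_comm]
  -- `cov(hk, fg)`
  have c1 : |cov[fun σ => h σ * k σ, fun σ => f σ * g σ; μ]| ≤ 8 * N * (Mh * Sk + Mk * Sh) * (Mf * Sg + Mg * Sf) * E := by
    have h1 := abs_cov_prod_prod_le_S hd hN hc hv hb hP hVB ht hρ hW hμ hhm hhdep hMh hδh hkm hkdep hMk hδk hfm hfdep hMf hδf hgm hgdep hMg hδg
    rw [← hSf, ← hSg, ← hSh, ← hSk, hEsym] at h1; exact h1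
  -- `cov(k, fg)`, `cov(h, fg)`
  have c2 : |cov[k, fun σ => f σ * g σ; μ]| ≤ 8 * N * (Mf * Sg + Mg * Sf) * Sk * E := by
    have h1 := abs_cov_mul_le_S hd hN hc hv hb hP hVB ht hρ hW hμ hfm hfdep hMf hδf hgm hgdep hMg hδg hkm hkdep hMk hδk
    rw [← hSf, ← hSg, ← hSk] at h1
    have hflip : cov[k, fun σ => f σ * g σ; μ] = cov[fun σ => f σ * g σ, k; μ] := covariance_comm _ _
    rw [hflip]
    refine h1.trans ?_
    rw [hE]
    have := mul_exp_neg_setDistEdges_mono (t := t) (c := 8 * N * (Mf * Sg + Mg * Sf) * Sk) ht (by positivity)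
      (Finset.subset_union_right : Δk ⊆ Δh ∪ Δk) (subset_rfl : Δf ∪ Δg ⊆ Δf ∪ Δg) (fun hn => by rw [hSk_e hn]; ring)
      (fun hn => by obtain ⟨h1, h2⟩ := hunion_e hSf_e hSg_e hn; rw [h1, h2]; ring)
    rw [setDistEdges_comm Δk (Δf ∪ Δg), setDistEdges_comm (Δh ∪ Δk) (Δf ∪ Δg)] at this
    exact this
  have c3 : |cov[h, fun σ => f σ * g σ; μ]| ≤ 8 * N * (Mf * Sg + Mg * Sf) * Sh * E := by
    have h1 := abs_cov_mul_le_S hd hN hc hv hb hP hVB ht hρ hW hμ hfm hfdep hMf hδf hgm hgdep hMg hδg hhm hhdep hMh hδh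
    rw [← hSf, ← hSg, ← hSh] at h1
    have hflip : cov[h, fun σ => f σ * g σ; μ] = cov[fun σ => f σ * g σ, h; μ] := covariance_comm _ _
    rw [hflip]
    refine h1.trans ?_
    rw [hE]
    exact mul_exp_neg_setDistEdges_mono ht (by positivity) subset_rfl (Finset.subset_union_left : Δh ⊆ Δh ∪ Δk)
      (fun hn => by obtain ⟨h1, h2⟩ := hunion_e hSf_e hSg_e hn; rw [h1, h2]; ring) (fun hn => by rw [hSh_e hn]; ring)
  -- single-observable cross covariances
  have cfk : |cov[f, k; μ]| ≤ 8 * N * Sf * Sk * E := by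
    have h1 := abs_cov_le_S' hd hN hc hv hb hP hVB ht hρ hW hμ hfm hfdep hMf hδf hkm hkdep hMk hδk
    rw [← hSf, ← hSk] at h1
    refine h1.trans ?_; rw [hE]
    exact mul_exp_neg_setDistEdges_mono ht (by positivity) Finset.subset_union_left Finset.subset_union_right
      (fun hn => by rw [hSf_e hn]; ring) (fun hn => by rw [hSk_e hn]; ring)
  have cgk : |cov[g, k; μ]| ≤ 8 * N * Sg * Sk * E := by
    have h1 := abs_cov_le_S' hd hN hc hv hb hP hVB ht hρ hW hμ hgm hgdep hMg hδg hkm hkdep hMk hδk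
    rw [← hSg, ← hSk] at h1
    refine h1.trans ?_; rw [hE]
    exact mul_exp_neg_setDistEdges_mono ht (by positivity) Finset.subset_union_right Finset.subset_union_right
      (fun hn => by rw [hSg_e hn]; ring) (fun hn => by rw [hSk_e hn]; ring)
  have cgh : |cov[g, h; μ]| ≤ 8 * N * Sg * Sh * E := by
    have h1 := abs_cov_le_S' hd hN hc hv hb hP hVB ht hρ hW hμ hgm hgdep hMg hδg hhm hhdep hMh hδh
    rw [← hSg, ← hSh] at h1
    refine h1.trans ?_; rw [hE]
    exact mul_exp_neg_setDistEdges_mono ht (by positivity) Finset.subset_union_right Finset.subset_union_left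
      (fun hn => by rw [hSg_e hn]; ring) (fun hn => by rw [hSh_e hn]; ring)
  have cfh : |cov[f, h; μ]| ≤ 8 * N * Sf * Sh * E := by
    have h1 := abs_cov_le_S' hd hN hc hv hb hP hVB ht hρ hW hμ hfm hfdep hMf hδf hhm hhdep hMh hδh
    rw [← hSf, ← hSh] at h1
    refine h1.trans ?_; rw [hE]
    exact mul_exp_neg_setDistEdges_mono ht (by positivity) Finset.subset_union_left Finset.subset_union_left
      (fun hn => by rw [hSf_e hn]; ring) (fun hn => by rw [hSh_e hn]; ring)
  -- `cov(W,Y)`, `cov(Z,Y)`, `cov(W,X)`, `cov(Z,X)` in ds-1's naming: `cov(k,g)`, `cov(h,g)`, `cov(k,f)`, `cov(h,f)`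
  have ckg : |cov[k, g; μ]| ≤ 8 * N * Sg * Sk * E := by rw [covariance_comm]; exact cgk
  have chg : |cov[h, g; μ]| ≤ 8 * N * Sg * Sh * E := by rw [covariance_comm]; exact cgh
  have ckf : |cov[k, f; μ]| ≤ 8 * N * Sf * Sk * E := by rw [covariance_comm]; exact cfk
  have chf : |cov[h, f; μ]| ≤ 8 * N * Sf * Sh * E := by rw [covariance_comm]; exact cfh
  -- `cov(hk, g)`, `cov(hk, f)`
  have chkg : |cov[fun σ => h σ * k σ, g; μ]| ≤ 8 * N * (Mh * Sk + Mk * Sh) * Sg * E := by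
    have h1 := abs_cov_mul_le_S hd hN hc hv hb hP hVB ht hρ hW hμ hhm hhdep hMh hδh hkm hkdep hMk hδk hgm hgdep hMg hδg
    rw [← hSh, ← hSk, ← hSg] at h1
    refine h1.trans ?_; rw [← hEsym]
    exact mul_exp_neg_setDistEdges_mono ht (by positivity) subset_rfl (Finset.subset_union_right : Δg ⊆ Δf ∪ Δg)
      (fun hn => by obtain ⟨h1, h2⟩ := hunion_e hSh_e hSk_e hn; rw [h1, h2]; ring) (fun hn => by rw [hSg_e hn]; ring)
  have chkf : |cov[fun σ => h σ * k σ, f; μ]| ≤ 8 * N * (Mh * Sk + Mk * Sh) * Sf * E := by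
    have h1 := abs_cov_mul_le_S hd hN hc hv hb hP hVB ht hρ hW hμ hhm hhdep hMh hδh hkm hkdep hMk hδk hfm hfdep hMf hδf
    rw [← hSh, ← hSk, ← hSf] at h1
    refine h1.trans ?_; rw [← hEsym]
    exact mul_exp_neg_setDistEdges_mono ht (by positivity) subset_rfl (Finset.subset_union_left : Δf ⊆ Δf ∪ Δg)
      (fun hn => by obtain ⟨h1, h2⟩ := hunion_e hSh_e hSk_e hn; rw [h1, h2]; ring) (fun hn => by rw [hSf_e hn]; ring)
  -- means and crude covariance bounds
  have mf := Summit.Ventures.YMGap.CouplingResponse.abs_integral_le_of_abs_le (μ := μ) hMf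
  have mg := Summit.Ventures.YMGap.CouplingResponse.abs_integral_le_of_abs_le (μ := μ) hMg
  have mh := Summit.Ventures.YMGap.CouplingResponse.abs_integral_le_of_abs_le (μ := μ) hMh
  have mk := Summit.Ventures.YMGap.CouplingResponse.abs_integral_le_of_abs_le (μ := μ) hMk
  -- the five groups of the pair form
  have P1 : |cov[fun σ => h σ * k σ, fun σ => f σ * g σ; μ] - (∫ σ, h σ ∂μ) * cov[k, fun σ => f σ * g σ; μ] -
      (∫ σ, k σ ∂μ) * cov[h, fun σ => f σ * g σ; μ]| ≤ 16 * N * (Mh * Sk + Mk * Sh) * (Mf * Sg + Mg * Sf) * E := by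
    refine (abs_sub _ _).trans ((add_le_add (abs_sub _ _) le_rfl).trans ?_)
    rw [abs_mul, abs_mul]
    have e2 := mul_le_mul mh c2 (abs_nonneg _) hMh0
    have e3 := mul_le_mul mk c3 (abs_nonneg _) hMk0
    have : 8 * N * (Mh * Sk + Mk * Sh) * (Mf * Sg + Mg * Sf) * E + Mh * (8 * N * (Mf * Sg + Mg * Sf) * Sk * E) +
        Mk * (8 * N * (Mf * Sg + Mg * Sf) * Sh * E) = 16 * N * (Mh * Sk + Mk * Sh) * (Mf * Sg + Mg * Sf) * E := by ring
    linarith [c1, e2, e3]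
  have P2 : |cov[f, k; μ] * cov[g, h; μ]| ≤ 8 * N * Sf * Sk * E * (2 * Mg * Mh) := by
    rw [abs_mul]; exact mul_le_mul cfk (abs_cov_le_two_mul hgm hhm hMg hMh) (abs_nonneg _) (by positivity)
  have P3 : |(∫ σ, f σ ∂μ) * (cov[fun σ => h σ * k σ, g; μ] - (∫ σ, h σ ∂μ) * cov[k, g; μ] - (∫ σ, k σ ∂μ) * cov[h, g; μ])| ≤
      Mf * (16 * N * (Mh * Sk + Mk * Sh) * Sg * E) := by
    rw [abs_mul]
    refine mul_le_mul mf ?_ (abs_nonneg _) hMf0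
    refine (abs_sub _ _).trans ((add_le_add (abs_sub _ _) le_rfl).trans ?_)
    rw [abs_mul, abs_mul]
    have e2 := mul_le_mul mh ckg (abs_nonneg _) hMh0
    have e3 := mul_le_mul mk chg (abs_nonneg _) hMk0
    have : 8 * N * (Mh * Sk + Mk * Sh) * Sg * E + Mh * (8 * N * Sg * Sk * E) + Mk * (8 * N * Sg * Sh * E) =
        16 * N * (Mh * Sk + Mk * Sh) * Sg * E := by ring
    linarith [chkg, e2, e3]
  have P4 : |cov[g, k; μ] * cov[f, h; μ]| ≤ 8 * N * Sg * Sk * E * (2 * Mf * Mh) := by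
    rw [abs_mul]; exact mul_le_mul cgk (abs_cov_le_two_mul hfm hhm hMf hMh) (abs_nonneg _) (by positivity)
  have P5 : |(∫ σ, g σ ∂μ) * (cov[fun σ => h σ * k σ, f; μ] - (∫ σ, h σ ∂μ) * cov[k, f; μ] - (∫ σ, k σ ∂μ) * cov[h, f; μ])| ≤
      Mg * (16 * N * (Mh * Sk + Mk * Sh) * Sf * E) := by
    rw [abs_mul]
    refine mul_le_mul mg ?_ (abs_nonneg _) hMg0
    refine (abs_sub _ _).trans ((add_le_add (abs_sub _ _) le_rfl).trans ?_)
    rw [abs_mul, abs_mul]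
    have e2 := mul_le_mul mh ckf (abs_nonneg _) hMh0
    have e3 := mul_le_mul mk chf (abs_nonneg _) hMk0
    have : 8 * N * (Mh * Sk + Mk * Sh) * Sf * E + Mh * (8 * N * Sf * Sk * E) + Mk * (8 * N * Sf * Sh * E) =
        16 * N * (Mh * Sk + Mk * Sh) * Sf * E := by ring
    linarith [chkf, e2, e3]
  refine (abs_sub4_le _ _ _ _ _).trans ?_
  -- `M_h S_k ≤ M_h S_k + M_k S_h` closes the bookkeeping
  have hx : 16 * N * Sf * Sk * E * Mg * Mh + 16 * N * Sg * Sk * E * Mf * Mh ≤ 16 * N * (Mh * Sk + Mk * Sh) * (Mf * Sg + Mg * Sf) * E := by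
    have h1 : 0 ≤ 16 * N * (Mk * Sh) * (Mf * Sg + Mg * Sf) * E := by positivity
    have h2 : 16 * N * (Mh * Sk + Mk * Sh) * (Mf * Sg + Mg * Sf) * E =
        (16 * N * Sf * Sk * E * Mg * Mh + 16 * N * Sg * Sk * E * Mf * Mh) + 16 * N * (Mk * Sh) * (Mf * Sg + Mg * Sf) * E := by ring
    rw [h2]; linarith
  calc _ ≤ 16 * N * (Mh * Sk + Mk * Sh) * (Mf * Sg + Mg * Sf) * E + 8 * N * Sf * Sk * E * (2 * Mg * Mh) +
        Mf * (16 * N * (Mh * Sk + Mk * Sh) * Sg * E) + 8 * N * Sg * Sk * E * (2 * Mf * Mh) + Mg * (16 * N * (Mh * Sk + Mk * Sh) * Sf * E) :=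
        add_le_add (add_le_add (add_le_add (add_le_add P1 P2) P3) P4) P5
    _ = 2 * (16 * N * (Mh * Sk + Mk * Sh) * (Mf * Sg + Mg * Sf) * E) + (16 * N * Sf * Sk * E * Mg * Mh + 16 * N * Sg * Sk * E * Mf * Mh) := by
        ring
    _ ≤ 2 * (16 * N * (Mh * Sk + Mk * Sh) * (Mf * Sg + Mg * Sf) * E) + 16 * N * (Mh * Sk + Mk * Sh) * (Mf * Sg + Mg * Sf) * E :=
        add_le_add le_rfl hx
    _ = 48 * N * (Mf * Sg + Mg * Sf) * (Mh * Sk + Mk * Sh) * E := by ring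

end SUN

end Summit.Ventures.YMGap.RobustBall

end
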